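import Summits.AtomisticToContinuum.FouriersLaw.Theorems.BondHeatUncertaintyExtensiveSnapshotIrreversibilityEnergyWindowDilationArrival1

/-!
# PART X-2 «DilationArrival»: the arrival side (EBᵃ)/(XBᶠ) from the arrival duals, junctions S3 / K_fix, the record over (RW₁ᶜ) — part 2 of 2 (sequel of `…BondHeatUncertaintyExtensiveSnapshotIrreversibilityEnergyWindowDilationArrival1`)

Split for the 400-line cap by the landing lane (hand-2 g33); the module docstring of part 1 (`…BondHeatUncertaintyExtensiveSnapshotIrreversibilityEnergyWindowDilationArrival1`) describes the whole node.  Same namespace; all FQNs unchanged.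
0 sorry; standard axioms.
-/

noncomputable section

namespace Summit.AtomisticToContinuum.FouriersLaw.Theorems.ExtensiveSnapshotIrreversibility.EnergyWindow

open MeasureTheory Filter Topology Real Set Metric
open scoped ENNReal NNReal ContDiff
open Literature.MathematicalPhysics.KineticTheory.HeatConduction Literature.Probability.Process

variable {N : ℕ}

/-- ★ **(SD₁) index `2` ∧ (SD₁q) index `1` ⟹ (XBᶠ)**: the far-half exchange bound from the order-1
ARRIVAL score duals in the momentum and position directions.  For `s ∈ [½, 1]`,
`u = P^δ_{1−s} h ∈ C^∞`, `|u| ≤ e^{2γTθ} e^{θH}`; truncation by `χ_R`, two integrations by parts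
against `p(s,z,·)` (divergence-free field), the boundary-free cutoff term `≤ A/R` by CEHR, the
two main terms by the arrival duals with test functions `χ_R u p_b`, `χ_R u ∂_{q_b}H`
(`≤ K e^{2γTθ} e^{(θ+ε)H}` uniformly in `R`), dominated convergence `R → ∞`.
[cite: CuneoEckmannHairerReyBellet2018, §3 eq. (3.2)–(3.4)] -/
theorem exchangeTermBoundFar_of_scoreDuals (hP : DensityScoreDualBoundOn {2})
    (hQ : DensityScoreDualBoundPositionOn {1}) : ExchangeTermBoundFar := by
  intro ω₂ lam β γ hω hl hβ hγ T hT N hN θ θ' hθ hθθ' hθ'1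
  have hθ'0 : 0 < θ' := hθ.trans hθθ'
  have hgap : 0 < θ' - θ := sub_pos.2 hθθ'
  set ε : ℝ := (θ' - θ) / 2 with hε
  have hε0 : 0 < ε := by positivity
  set θ₁ : ℝ := θ + ε with hθ₁
  have hθ₁0 : 0 < θ₁ := by positivity
  have hθ₁θ' : θ₁ < θ' := by rw [hθ₁, hε]; linarith
  have hθ₁ε : θ₁ + ε = θ' := by rw [hθ₁, hε]; ring
  set r : ℝ := θ' / θ₁ with hr
  have hr1 : 1 < r := (one_lt_div hθ₁0).2 hθ₁θ'
  have hrθ : r * θ₁ = θ' := by rw [hr]; field_simp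
  obtain ⟨δ₁, C₁, hδ₁, hC₁, hW₁⟩ := hP ω₂ lam β γ hω hl hβ hγ T hT N hN r ε hr1 hε0
  obtain ⟨δ₂, C₂, hδ₂, hC₂, hW₂⟩ := hQ ω₂ lam β γ hω hl hβ hγ T hT N hN r ε hr1 hε0
  obtain ⟨K, hK0, hK⟩ := exists_bathCoeff_le_exp hω hl.le hβ.le hγ.le N hε0
  have hTθ : θ' * T < 1 := by rwa [lt_div_iff₀ hT] at hθ'1
  have hg : 0 < 1 / θ' - T := by rw [sub_pos, lt_div_iff₀ hθ'0]; linarith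
  set P := pinnedChain ω₂ lam β γ with hPdef
  set H := P.hamiltonian N with hH
  set E₀ : ℝ := Real.exp (θ * γ * (T + T)) with hE₀
  set E₁ : ℝ := Real.exp (θ₁ * γ * (T + T)) with hE₁
  set M : ℝ := (K * E₀) * (E₁ * (C₂ + C₁)) with hM
  have hM0 : 0 ≤ M := by positivity
  refine ⟨min (min δ₁ δ₂) (min T (1 / θ' - T)), M, lt_min (lt_min hδ₁ hδ₂) (lt_min hT hg),
    fun δ hδ h hhC hhc hhθ b hb z s hs12 hs1 => ?_⟩
  have hδ₁' : |δ| < δ₁ := lt_of_lt_of_le hδ ((min_le_left _ _).trans (min_le_left _ _))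
  have hδ₂' : |δ| < δ₂ := lt_of_lt_of_le hδ ((min_le_left _ _).trans (min_le_right _ _))
  obtain ⟨hL, hR, hθmax⟩ :=
    twoTemperature_window hT hθ'0 hθ'1 (lt_of_lt_of_le hδ (min_le_right _ _))
  have hN0 : 0 < N := by omega
  obtain ⟨p, hp⟩ := isTransitionDensity_exists hω hl.le hβ.le hγ hN0 hL hR.le
  have hs0 : 0 < s := by linarith
  have ht0 : 0 ≤ 1 - s := by linarith
  have ht1 : 1 - s ≤ 1 := by linarith
  have h2T : T + δ / 2 + (T - δ / 2) = T + T := by ring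
  have hθmax₀ : θ < 1 / max (T + δ / 2) (T - δ / 2) := hθθ'.trans hθmax
  have hθmax₁ : θ₁ < 1 / max (T + δ / 2) (T - δ / 2) := hθ₁θ'.trans hθmax
  -- the orbit `u = P^δ_{1-s} h`: smooth, CEHR growth
  set u : PhaseSpace N → ℝ := pertKernelFun ω₂ lam β γ T δ N h (1 - s) with hu
  have huC : ContDiff ℝ ∞ u := contDiff_pertKernelFun hω hl.le hβ.le hγ.le hp hhC hhc ht0
  have hu1 : ContDiff ℝ 1 u := huC.of_le (by exact_mod_cast le_top)
  have hub : ∀ w, |u w| ≤ E₀ * Real.exp (θ * H w) := fun w =>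
    abs_pertKernelFun_le hω hl hβ hγ hN0 hT hL hR hθ hθmax₀ hhC.continuous.measurable hhθ ht0
      ht1 w
  -- the coefficient `a = ∂_{q_b}H = dPotential`
  have hUd : Differentiable ℝ P.U :=
    (pinnedChain_contDiff_U ω₂ lam β γ (n := 1)).differentiable one_ne_zero
  have hVd : Differentiable ℝ P.V :=
    (pinnedChain_contDiff_V ω₂ lam β γ (n := 1)).differentiable one_ne_zero
  have haC : ContDiff ℝ ∞ (P.dPotential N b) :=
    P.contDiff_dPotential (pinnedChain_contDiff_U ω₂ lam β γ) (pinnedChain_contDiff_V ω₂ lam β γ)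
      N b
  have ha1 : ContDiff ℝ 1 (P.dPotential N b) := haC.of_le (by exact_mod_cast le_top)
  have haH : ∀ w : PhaseSpace N, partialQ b H w = P.dPotential N b w.1 := fun w =>
    P.partialQ_hamiltonian_eq_dPotential hUd hVd N w b
  have hab : ∀ w : PhaseSpace N, |P.dPotential N b w.1| ≤ K * Real.exp (ε * H w) := fun w => by
    rw [← haH w]; exact (hK b w).2
  -- the integrand `F = 𝒜_b u`
  set F : PhaseSpace N → ℝ := bathExchange P N b u with hF
  have hFe : F = fun w => w.2 b * partialQ b u w + P.dPotential N b w.1 * partialP b u w := by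
    funext w; rw [hF]; dsimp only [bathExchange]; rw [haH w]
  have hu'q : Continuous (partialQ b u) :=
    (contDiff_partialQ huC (m := 0) (by exact_mod_cast le_top) b).continuous
  have hu'p : Continuous (partialP b u) := continuous_partialP_of_contDiff b hu1
  have hFc : Continuous F := by
    rw [hFe]
    exact (((continuous_apply b).comp continuous_snd).mul hu'q).add
      ((haC.continuous.comp continuous_fst).mul hu'p)
  set μ : Measure (PhaseSpace N) := pertKernel ω₂ lam β γ T δ N s z with hμ
  change |∫ w, F w ∂μ| ≤ M * Real.exp (θ' * H z)
  by_cases hint : Integrable F μ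
  swap
  · rw [integral_undef hint, abs_zero]; positivity
  -- the departure density `f₀ = p(s,z,·)` and the conversion `∫ g dμ = ∫ f₀ g`
  set f₀ : PhaseSpace N → ℝ := p s z with hf₀
  have hf₀C : ContDiff ℝ ∞ f₀ := hp.contDiff_right_top hs0 z
  have hf₀1 : ContDiff ℝ 1 f₀ := hf₀C.of_le (by exact_mod_cast le_top)
  have hconv : ∀ g : PhaseSpace N → ℝ, ∫ w, g w ∂μ = ∫ w, f₀ w * g w := fun g => by
    rw [hμ]
    simp only [pertKernel]
    rw [hp.kernel_eq hs0 z,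
      integral_withDensity_ofReal_phaseSpace hf₀C.continuous.measurable (hp.2.1 s hs0 z)]
  -- cutoff derivative constants
  obtain ⟨Kq, hKq0, hKq⟩ := exists_bound_fderiv_ewBump N ((Pi.single b 1, 0) : PhaseSpace N)
  obtain ⟨Kp, hKp0, hKp⟩ :=
    exists_bound_fderiv_ewBump N (((0 : Fin N → ℝ), Pi.single b 1) : PhaseSpace N)
  set A : ℝ := (K * E₀ * (Kq + Kp)) * (E₁ * Real.exp (θ₁ * H z)) with hA
  set B : ℝ := M * Real.exp (θ' * H z) with hB
  have tri : ∀ a₁ a₂ a₃ : ℝ, |-a₁ - a₂ - a₃| ≤ |a₁| + |a₂| + |a₃| := fun a₁ a₂ a₃ => by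
    calc |-a₁ - a₂ - a₃| ≤ |-a₁ - a₂| + |a₃| := abs_sub _ _
      _ ≤ |-a₁| + |a₂| + |a₃| := by gcongr; exact abs_sub _ _
      _ = |a₁| + |a₂| + |a₃| := by rw [abs_neg]
  -- the truncations
  have key : ∀ n : ℕ,
      |∫ w, ewCutoff N ((n : ℝ) + 1) w * F w ∂μ| ≤ B + A * (1 / ((n : ℝ) + 1)) := by
    intro n
    set R : ℝ := (n : ℝ) + 1 with hRdef
    have hRp : 0 < R := by positivity
    set χ : PhaseSpace N → ℝ := ewCutoff N R with hχ
    have hχC : ContDiff ℝ ∞ χ := ewCutoff_contDiff R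
    have hχ1 : ContDiff ℝ 1 χ := ewCutoff_contDiff R
    have hχc : HasCompactSupport χ := hasCompactSupport_ewCutoff hRp
    have hχle : ∀ w, |χ w| ≤ 1 := abs_ewCutoff_le_one R
    have hχq : ∀ w, |partialQ b χ w| ≤ Kq / R := abs_partialQ_ewCutoff_le hKq hRp
    have hχp : ∀ w, |partialP b χ w| ≤ Kp / R := abs_partialP_ewCutoff_le hKp hRp
    -- by parts against the density
    have hibp : ∫ w, χ w * F w ∂μ =
        -(∫ y, u y * (f₀ y * (y.2 b * partialQ b χ y + P.dPotential N b y.1 * partialP b χ y))) -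
          (∫ y, (χ y * (u y * y.2 b)) * partialQ b f₀ y) -
            ∫ y, (χ y * (u y * P.dPotential N b y.1)) * partialP b f₀ y := by
      rw [hconv, hFe]
      exact integral_mul_cutoff_exchange_eq b hχ1 hχc hu1 hf₀1 ha1
    -- term 1: the cutoff derivatives, CEHR (3.4) at rate `θ₁`
    have hT1 : |∫ y, u y * (f₀ y * (y.2 b * partialQ b χ y + P.dPotential N b y.1 *
        partialP b χ y))| ≤ A * (1 / R) := by
      have e : ∫ y, u y * (f₀ y * (y.2 b * partialQ b χ y + P.dPotential N b y.1 *
          partialP b χ y)) = ∫ w, u w * (w.2 b * partialQ b χ w + P.dPotential N b w.1 *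
          partialP b χ w) ∂μ := by
        rw [hconv]
        exact integral_congr_ae (ae_of_all _ fun y => by ring)
      rw [e]
      have hχ'q : Continuous (partialQ b χ) :=
        (contDiff_partialQ hχC (m := 0) (by exact_mod_cast le_top) b).continuous
      have hχ'p : Continuous (partialP b χ) := continuous_partialP_of_contDiff b hχ1
      have hψm : Measurable fun w : PhaseSpace N => u w * (w.2 b * partialQ b χ w +
          P.dPotential N b w.1 * partialP b χ w) :=
        (huC.continuous.mul ((((continuous_apply b).comp continuous_snd).mul hχ'q).add
          ((haC.continuous.comp continuous_fst).mul hχ'p))).measurable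
      have hL0 : 0 ≤ K * E₀ * (Kq + Kp) * (1 / R) := by positivity
      have hψb : ∀ w : PhaseSpace N, |u w * (w.2 b * partialQ b χ w +
          P.dPotential N b w.1 * partialP b χ w)| ≤
          K * E₀ * (Kq + Kp) * (1 / R) * Real.exp (θ₁ * H w) := fun w => by
        rw [abs_mul]
        have hin : |w.2 b * partialQ b χ w + P.dPotential N b w.1 * partialP b χ w| ≤
            (K * Real.exp (ε * H w)) * (Kq / R) + (K * Real.exp (ε * H w)) * (Kp / R) := by
          refine (abs_add_le _ _).trans (add_le_add ?_ ?_)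
          · rw [abs_mul]
            exact mul_le_mul (hK b w).1 (hχq w) (abs_nonneg _) (by positivity)
          · rw [abs_mul]
            exact mul_le_mul (hab w) (hχp w) (abs_nonneg _) (by positivity)
        calc |u w| * |w.2 b * partialQ b χ w + P.dPotential N b w.1 * partialP b χ w|
            ≤ (E₀ * Real.exp (θ * H w)) *
                ((K * Real.exp (ε * H w)) * (Kq / R) + (K * Real.exp (ε * H w)) * (Kp / R)) :=
              mul_le_mul (hub w) hin (abs_nonneg _) (by positivity)
          _ = K * E₀ * (Kq + Kp) * (1 / R) * Real.exp (θ₁ * H w) := by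
              rw [hθ₁, add_mul θ ε (H w), Real.exp_add]; field_simp
      obtain ⟨-, hout⟩ := integrable_and_abs_integral_transitionKernel_le hω hl hβ hγ hN0 hL hR
        hθ₁0 hθmax₁ s.toNNReal z hL0 hψm hψb
      simp only [Real.coe_toNNReal _ hs0.le, h2T] at hout
      have hexp : Real.exp (θ₁ * γ * (T + T) * s) ≤ E₁ :=
        Real.exp_le_exp.2 (mul_le_of_le_one_right (by positivity) hs1)
      calc _ ≤ K * E₀ * (Kq + Kp) * (1 / R) *
            (Real.exp (θ₁ * γ * (T + T) * s) * Real.exp (θ₁ * H z)) := hout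
        _ ≤ K * E₀ * (Kq + Kp) * (1 / R) * (E₁ * Real.exp (θ₁ * H z)) :=
            mul_le_mul_of_nonneg_left (mul_le_mul_of_nonneg_right hexp (Real.exp_pos _).le) hL0
        _ = A * (1 / R) := by rw [hA]; ring
    -- the CEHR root bound with constant `K E₀` at rate `θ₁`, from `z` at time `s`
    have hroot : ∀ {G : PhaseSpace N → ℝ}, (∀ y, |G y| ≤ (K * E₀) * Real.exp (θ₁ * H y)) →
        (∫ y, |G y| ^ r * p s z y) ^ (1 / r) ≤ (K * E₀) * (E₁ * Real.exp (θ₁ * H z)) :=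
      fun hGb => by
        have h0 := rpow_integral_abs_rpow_mul_density_le_of_le_mul hω hl hβ hγ hN0 hL hR hθ₁0
          hr1 (by rwa [hrθ]) hp hs0 hs1 z (by positivity) hGb
        rwa [h2T] at h0
    -- term 2: the position ARRIVAL dual (index 1) with `G = χ u p_b`
    have hT2 : |∫ y, (χ y * (u y * y.2 b)) * partialQ b f₀ y| ≤
        ((K * E₀) * (E₁ * Real.exp (θ₁ * H z))) * (C₂ * Real.exp (ε * H z)) := by
      have hGC : ContDiff ℝ ∞ fun y : PhaseSpace N => χ y * (u y * y.2 b) :=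
        hχC.mul (huC.mul (contDiff_momentum_coord b))
      have hGc : HasCompactSupport fun y : PhaseSpace N => χ y * (u y * y.2 b) := hχc.mul_right
      have hGb : ∀ y, |χ y * (u y * y.2 b)| ≤ (K * E₀) * Real.exp (θ₁ * H y) := fun y => by
        rw [abs_mul, abs_mul]
        calc |χ y| * (|u y| * |y.2 b|)
            ≤ 1 * ((E₀ * Real.exp (θ * H y)) * (K * Real.exp (ε * H y))) :=
              mul_le_mul (hχle y) (mul_le_mul (hub y) (hK b y).1 (abs_nonneg _)
                (by positivity)) (by positivity) zero_le_one
          _ = (K * E₀) * Real.exp (θ₁ * H y) := by rw [hθ₁, add_mul, Real.exp_add]; ring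
      have hd := hW₂ δ hδ₂' p hp s hs12 hs1 b hb z _ hGC hGc 1 (Set.mem_singleton _)
      have e1 : ∀ y, densityDerivQ p s b z 1 y = partialQ b f₀ y := fun y => rfl
      simp only [e1] at hd
      exact hd.trans (mul_le_mul_of_nonneg_right (hroot hGb) (by positivity))
    -- term 3: the momentum ARRIVAL dual (index 2) with `G = χ u ∂_{q_b}H`
    have hT3 : |∫ y, (χ y * (u y * P.dPotential N b y.1)) * partialP b f₀ y| ≤
        ((K * E₀) * (E₁ * Real.exp (θ₁ * H z))) * (C₁ * Real.exp (ε * H z)) := by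
      have hGC : ContDiff ℝ ∞ fun y : PhaseSpace N => χ y * (u y * P.dPotential N b y.1) :=
        hχC.mul (huC.mul (haC.comp contDiff_fst))
      have hGc : HasCompactSupport fun y : PhaseSpace N => χ y * (u y * P.dPotential N b y.1) :=
        hχc.mul_right
      have hGb : ∀ y, |χ y * (u y * P.dPotential N b y.1)| ≤ (K * E₀) * Real.exp (θ₁ * H y) :=
        fun y => by
          rw [abs_mul, abs_mul]
          calc |χ y| * (|u y| * |P.dPotential N b y.1|)
              ≤ 1 * ((E₀ * Real.exp (θ * H y)) * (K * Real.exp (ε * H y))) :=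
                mul_le_mul (hχle y) (mul_le_mul (hub y) (hab y) (abs_nonneg _)
                  (by positivity)) (by positivity) zero_le_one
            _ = (K * E₀) * Real.exp (θ₁ * H y) := by rw [hθ₁, add_mul, Real.exp_add]; ring
      have hd := hW₁ δ hδ₁' p hp s hs12 hs1 b hb z _ hGC hGc 2 (Set.mem_singleton _)
      have e1 : ∀ y, densityDeriv p s b z 2 y = partialP b f₀ y := fun y => rfl
      simp only [e1] at hd
      exact hd.trans (mul_le_mul_of_nonneg_right (hroot hGb) (by positivity))
    rw [hibp]
    calc _ ≤ |∫ y, u y * (f₀ y * (y.2 b * partialQ b χ y + P.dPotential N b y.1 *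
              partialP b χ y))| + |∫ y, (χ y * (u y * y.2 b)) * partialQ b f₀ y| +
            |∫ y, (χ y * (u y * P.dPotential N b y.1)) * partialP b f₀ y| := tri _ _ _
      _ ≤ A * (1 / R) + ((K * E₀) * (E₁ * Real.exp (θ₁ * H z))) * (C₂ * Real.exp (ε * H z)) +
            ((K * E₀) * (E₁ * Real.exp (θ₁ * H z))) * (C₁ * Real.exp (ε * H z)) :=
          add_le_add (add_le_add hT1 hT2) hT3
      _ = B + A * (1 / R) := by
          rw [hB, hM, ← hθ₁ε, add_mul θ₁ ε (H z), Real.exp_add]; ring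
  -- `R → ∞`: dominated convergence `χ_R F → F`
  have hlim : Tendsto (fun n : ℕ => ∫ w, ewCutoff N ((n : ℝ) + 1) w * F w ∂μ) atTop
      (𝓝 (∫ w, F w ∂μ)) := by
    refine tendsto_integral_of_dominated_convergence (fun w => ‖F w‖)
      (fun n => ((ewCutoff_contDiff (n := 1) _).continuous.mul hFc).aestronglyMeasurable)
      hint.norm (fun n => ae_of_all _ fun w => ?_) (ae_of_all _ fun w => ?_)
    · rw [norm_mul, Real.norm_eq_abs (ewCutoff _ _ _)]
      exact mul_le_of_le_one_left (norm_nonneg _) (abs_ewCutoff_le_one _ w)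
    · refine tendsto_const_nhds.congr' ?_
      filter_upwards [Filter.eventually_ge_atTop ⌈‖w‖⌉₊] with n hn
      rw [ewCutoff_eq_one (by positivity) ?_, one_mul]
      calc ‖w‖ ≤ (⌈‖w‖⌉₊ : ℝ) := Nat.le_ceil _
        _ ≤ (n : ℝ) := by exact_mod_cast hn
        _ ≤ (n : ℝ) + 1 := by linarith
  have hlim' : Tendsto (fun n : ℕ => B + A * (1 / ((n : ℝ) + 1))) atTop (𝓝 (B + A * 0)) :=
    tendsto_const_nhds.add ((tendsto_one_div_add_atTop_nhds_zero_nat (𝕜 := ℝ)).const_mul _)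
  have hle := le_of_tendsto_of_tendsto' hlim.abs hlim' key
  simpa using hle

/-! ## 2. Junctions: S3 and K_fix from the order-1 duals; the record `(Dᵛ) ∧ (RW₁) ∧ (SD₁q)` -/

/-- ★★ **`(Dᵛ) → (SD₁) → (SD₁q) → S3`** (`KernelTemperatureLipschitz`): all four bounds
(EBᵃ), (EBᵈ), (XBⁿ), (XBᶠ) of the dilation Duhamel record `kernelTemperatureLipschitz_of_dilation`
are discharged by the order-1 departure/arrival score duals in the momentum direction
((SD₁) `DensityScoreDualBoundFirst`, indices `{0, 2}`) and the position direction
((SD₁q) `DensityScoreDualBoundPosition`, indices `{0, 1}`). [folklore] -/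
theorem kernelTemperatureLipschitz_of_dilation_duals (hV : KernelTemperatureDilationDuhamel)
    (h : DensityScoreDualBoundFirst) (hq : DensityScoreDualBoundPosition) :
    KernelTemperatureLipschitz :=
  kernelTemperatureLipschitz_of_dilation_first hV
    (dilationArrivalBound_of_scoreDual (densityScoreDualBoundOn_mono (by simp) h)) h hq
    (exchangeTermBoundFar_of_scoreDuals (densityScoreDualBoundOn_mono (by simp) h)
      (densityScoreDualBoundPositionOn_mono (Set.subset_univ _) hq))

/-- ★★ **RECORD JUNCTION after part X-2**: `(Dᵛ) → (RW₁) → (SD₁q) → S3` — the momentum duals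
(SD₁) are supplied by the tree's order-1 junction (SD₁) ⟸ (MC∞) ∧ (RW₁)
(`densityScoreDualBoundFirst_of_gram`, part V) with (MC∞) PROVED
(`skeletonGramLimitInverseMoments_proved`), so the open leaves beneath S3 are exactly
(Dᵛ) `KernelTemperatureDilationDuhamel`, (RW₁) `GramControlledWeightMoments` and
(SD₁q) `DensityScoreDualBoundPosition`. [folklore] -/
theorem kernelTemperatureLipschitz_of_dilation_gram₂ (hV : KernelTemperatureDilationDuhamel)
    (hRW : GramControlledWeightMoments) (hq : DensityScoreDualBoundPosition) :
    KernelTemperatureLipschitz :=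
  kernelTemperatureLipschitz_of_dilation_duals hV
    (densityScoreDualBoundFirst_of_gram skeletonGramLimitInverseMoments_proved hRW) hq

/-- ★★ **`K_fix ⟸ A0 ∧ A2 ∧ (Dᵛ) ∧ (SD₁) ∧ (SD₁q) ∧ A3p ∧ A4`** (`SnapshotKLUpperExpansion`, via
`snapshotKLUpperExpansion_of_atoms₅K`). [folklore] -/
theorem snapshotKLUpperExpansion_of_atoms₇DD (h0 : NessGibbsReweighting)
    (h2 : NessOddLogRatioBound) (hV : KernelTemperatureDilationDuhamel)
    (h : DensityScoreDualBoundFirst) (hq : DensityScoreDualBoundPosition)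
    (h3p : NessFloorMeanValue) (h4 : NessLinearResponseL2) : SnapshotKLUpperExpansion :=
  snapshotKLUpperExpansion_of_atoms₅K h0 h2 (kernelTemperatureLipschitz_of_dilation_duals hV h hq)
    h3p h4

/-- ★★ **The K_fix junction of record after X-2**:
`K_fix ⟸ A0 ∧ A2 ∧ (Dᵛ) ∧ (RW₁) ∧ (SD₁q) ∧ A3p ∧ A4`. [folklore] -/
theorem snapshotKLUpperExpansion_of_atoms₇DG (h0 : NessGibbsReweighting)
    (h2 : NessOddLogRatioBound) (hV : KernelTemperatureDilationDuhamel)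
    (hRW : GramControlledWeightMoments) (hq : DensityScoreDualBoundPosition)
    (h3p : NessFloorMeanValue) (h4 : NessLinearResponseL2) : SnapshotKLUpperExpansion :=
  snapshotKLUpperExpansion_of_atoms₅K h0 h2 (kernelTemperatureLipschitz_of_dilation_gram₂ hV hRW hq)
    h3p h4

/-! ## 3. The record over the coordinate-generic prover target (RW₁ᶜ) -/

/-- ★★ **RECORD JUNCTION over (RW₁ᶜ)**: `(Dᵛ) → (RW₁ᶜ) → (SD₁q) → S3` — the prover seat's
target after critic row 1245 (2) is the coordinate-generic weight-moment bound (RW₁ᶜ)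
`GramControlledWeightMomentsCoord` (addendum X-2C), whose momentum instance `c = inr b` is (RW₁)
(`gramControlledWeightMoments_of_coord`, definitional) and whose position instance `c = inl b` is
the input of the deferred position junction beneath (SD₁q). [folklore] -/
theorem kernelTemperatureLipschitz_of_dilation_coord (hV : KernelTemperatureDilationDuhamel)
    (hRW : GramControlledWeightMomentsCoord) (hq : DensityScoreDualBoundPosition) :
    KernelTemperatureLipschitz :=
  kernelTemperatureLipschitz_of_dilation_gram₂ hV (gramControlledWeightMoments_of_coord hRW) hq

/-- ★★ `K_fix ⟸ A0 ∧ A2 ∧ (Dᵛ) ∧ (RW₁ᶜ) ∧ (SD₁q) ∧ A3p ∧ A4`. [folklore] -/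
theorem snapshotKLUpperExpansion_of_atoms₇DC (h0 : NessGibbsReweighting)
    (h2 : NessOddLogRatioBound) (hV : KernelTemperatureDilationDuhamel)
    (hRW : GramControlledWeightMomentsCoord) (hq : DensityScoreDualBoundPosition)
    (h3p : NessFloorMeanValue) (h4 : NessLinearResponseL2) : SnapshotKLUpperExpansion :=
  snapshotKLUpperExpansion_of_atoms₅K h0 h2 (kernelTemperatureLipschitz_of_dilation_coord hV hRW hq)
    h3p h4

end Summit.AtomisticToContinuum.FouriersLaw.Theorems.ExtensiveSnapshotIrreversibility.EnergyWindow

end
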